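import Mathlib.FieldTheory.Finite.Basic
import Literature.NumberTheory.QuadraticForms.HermitianUnimodularLocalRing   -- ★ `HermitianUnimodular.exists_isUnit_formCongr_diag` (the unit pivot; needs only (trace))
import Literature.NumberTheory.Automorphic.UnitaryGroupSelfDualLocus          -- ★ `formCongr_mul_eq_formCongr_formCongr`, `formCongr_hermitian`
import HarnessLib

/-!
# Unimodular hermitian PLANES over a local ring with a RESIDUALLY TRIVIAL involution (the tamely RAMIFIED case): two such Gram matrices are
# congruent iff their determinants agree modulo norms (Jacobowitz 1962, §8; O'Meara, §92)

Topic `NumberTheory/QuadraticForms`; namespace `Literature.NumberTheory.QuadraticForms.HermitianUnimodularRamified`.  KERNEL ONLY: theorems, no definition, no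
instance, no notation, no named fact, no `sorry`; pure commutative algebra.  Cell `pub/hodgecm-mathlib`, F0∕P3a, crux H413 = stmt-HodgeConjecture-24833, line
«N6nsGerm», (R2) Euler–Poincaré road, RAMIFIED half (census `F0/P3a/A-p06/g27/CENSUS-R2ram-RamifiedEulerPoincare.A-p06g27.md` §5 (r1); LEAD F0P3a-plan (g10)
T9-8 (B); seat A-p06 (g27), co-hand A-p17 (g22)): the ENGINE behind «`U(Φ₂)(E_w)` is transitive on the self-dual lattices of the plane at a tamely ramified
`w`» — the transitivity binder `hA` of A-p17's (T4) `RankOneEulerPoincareEllipticRelationOfTree` and of A-p06's (N2b).  HONEST LABEL: HC_CM is proved only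
modulo the printed citations until rung 0 closes.

WHY A NEW ENGINE.  ★ `HermitianUnimodular.exists_formCongr_eq` (any two unimodular `σ`-hermitian matrices are congruent) needs (norm) «every `σ`-fixed unit
is a norm `t σ t`», TRUE for an unramified quadratic extension and FALSE for a ramified one (`N(𝒪_w^×) = (𝒪_v^×)²` has index `2`): over the valuation
ring of a tamely ramified `E_w ∕ F_v` there are TWO classes of unimodular hermitian planes, told apart by `det ∈ 𝒪_v^× ∕ N(𝒪_w^×)` [Jacobowitz1962, §8].  But
all Gram matrices of ONE hermitian space share their determinant class — which is all the transitivity statement needs.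

SETTING.  `R` a commutative LOCAL ring, `σ` an involution of `R` with: (two) `2 ∈ R^×`; (res) `σ r − r ∈ 𝔪` for all `r` (σ is the identity on the residue
field — the RAMIFIED signature; then `σ`-ANTI-fixed elements lie in `𝔪`); (norm₁) every `σ`-fixed unit `≡ 1 (mod 𝔪)` is a norm `t σ t` (Hensel: at an odd
residue characteristic the principal units of `𝒪_v` are squares); and a FINITE residue field (then of odd cardinality, by (two)).  `H ∈ M₂(R)` is `σ`-HERMITIAN
(`(σH)ᵀ = H`) and UNIMODULAR (`det H ∈ R^×`); `formCongr σ T H = (σT)ᵀ H T` (★ `UnitaryGroupFormTransport`).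

* §1 `2 × 2` bookkeeping: `det_formCongr` (`det (formCongr σ T H) = det H · (det T · σ(det T))`), `formCongr_swap`, `formCongr_schur` (Schur split),
  `formCongr_normStep`, `formCongr_scale`, `formCongr_scale₂`, `diagonal_hermitian`.
* §2 `exists_add_map_eq_one` ((trace) from (two)), `exists_fixed_sub_mem` (σ-fixed lifts), `exists_sq_add_sq_sub_one_mem` (the residue form represents `1`),
  `exists_fixed_repr_norm`, `exists_formCongr_eq_diagonal` (pivot + Schur: `≅ diag(a, d)`), **`exists_formCongr_eq_diagonal_one`** — every unimodular hermitian `H ∈ M₂(R)` is congruent to `diag(1, δ)` (`δ` a `σ`-fixed unit): unit pivot (★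
  `exists_isUnit_formCongr_diag`, (trace) from (two)), Schur split to `diag(a, d)`, then REPRESENT A NORM: the binary form `a x² + d y²` over the finite residue
  field of odd order takes the value `1` (Mathlib `FiniteField.exists_root_sum_quadratic`), a `σ`-fixed lift gives `c = a x² + d y² ≡ 1`, a norm by (norm₁), and the
  basis `((x, y)∕t, (−d y, a x))` has Gram matrix `diag(1, a d c)`.
* §3 **`exists_formCongr_eq_of_det_eq_mul_norm`** — unimodular hermitian `H₁, H₂ ∈ M₂(R)` with `det H₂ = det H₁ · t σ(t)` are congruent:
  `∃ T : GL₂(R), formCongr σ T H₁ = H₂` (`t` need not be assumed a unit: it is forced).  (The converse direction is `det_formCongr`.)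

## References
* [Jacobowitz1962] R. Jacobowitz, *Hermitian forms over local fields*, Amer. J. Math. 84 (1962), §8 (ramified, non-dyadic: modular lattices of even order have an
  orthogonal basis and are classified by rank and discriminant).
* [Omeara1963] O. T. O'Meara, *Introduction to Quadratic Forms* (1963), §92:1–92:2 (unimodular lattices over local rings, odd residue characteristic).
* [Serre1979] J.-P. Serre, *Local Fields*, Ch. V §3 (tamely ramified extensions: norms of units are the squares times principal units).
-/

set_option autoImplicit false

open scoped Matrix
open Matrix Polynomial

namespace Literature.NumberTheory.QuadraticForms.HermitianUnimodularRamified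

open Literature.NumberTheory.Automorphic Literature.NumberTheory.Automorphic.UnitaryGroup

variable {R : Type*} [CommRing R] (σ : R →+* R)

/-! ## §1 `2 × 2` bookkeeping (any commutative ring) -/

section TwoByTwo

/-- The determinant of a congruent matrix: `det ((σT)ᵀ H T) = det H · (det T · σ(det T))` — congruence changes the determinant by a NORM. [cite: Omeara1963, §92:1] -/
theorem det_formCongr {ι : Type*} [Fintype ι] [DecidableEq ι] (T : GL ι R) (H : Matrix ι ι R) :
    (formCongr σ T H).det = H.det * ((T : Matrix ι ι R).det * σ (T : Matrix ι ι R).det) := by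
  rw [formCongr, Matrix.det_mul, Matrix.det_mul, Matrix.det_transpose, ← RingHom.mapMatrix_apply, ← RingHom.map_det]
  ring

/-- The matrix of `GeneralLinearGroup.mk'' A h` is `A`. [cite: Omeara1963, §92:1] -/
theorem coe_mk'' (A : Matrix (Fin 2) (Fin 2) R) (h : IsUnit A.det) :
    ((Matrix.GeneralLinearGroup.mk'' A h : GL (Fin 2) R) : Matrix (Fin 2) (Fin 2) R) = A := rfl

/-- Congruence by the SWAP `!![0, 1; 1, 0]` exchanges the diagonal entries (and transposes the off-diagonal ones). [cite: Omeara1963, §92:1] -/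
theorem formCongr_swap (M : Matrix (Fin 2) (Fin 2) R) (hS : IsUnit (!![(0 : R), 1; 1, 0]).det) :
    formCongr σ (Matrix.GeneralLinearGroup.mk'' _ hS) M = !![M 1 1, M 1 0; M 0 1, M 0 0] := by
  ext i j
  fin_cases i <;> fin_cases j <;>
    simp [formCongr, Matrix.mul_apply, Fin.sum_univ_two, Matrix.transpose_apply, Matrix.map_apply]

/-- **The Schur split**: for `H = !![a, b; σ b, e]` with `a` invertible (`a · a⁻ = 1`, `σ(a⁻) · a = 1`), the transvection `e₂ ↦ e₂ − a⁻ b e₁` makes `H` diagonal: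
`diag(a, e − σ(a⁻ b) b)`. [cite: Jacobowitz1962, §4 (4.2)–(4.4)] [cite: Omeara1963, §92:1] -/
theorem formCongr_schur {a b c e ai : R} (hai : a * ai = 1) (hσai : σ ai * a = 1) (hc : c = σ b) (hT : IsUnit (!![(1 : R), -(ai * b); 0, 1]).det) :
    formCongr σ (Matrix.GeneralLinearGroup.mk'' _ hT) !![a, b; c, e] = !![a, 0; 0, e - σ (ai * b) * b] := by
  ext i j
  fin_cases i <;> fin_cases j <;>
    simp [formCongr, Matrix.mul_apply, Fin.sum_univ_two, Matrix.transpose_apply, Matrix.map_apply, hc]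
  · linear_combination (-b) * hai
  · linear_combination (-(σ b)) * hσai
  · linear_combination (σ b * ai * b) * hσai

/-- **The norm step**: for `σ`-fixed `a, d, x, y`, the basis `((x, y), (−d y, a x))` turns `diag(a, d)` into `diag(c, a d c)` with `c = a x² + d y²` (the value
represented). [cite: Omeara1963, §92:1] [cite: Jacobowitz1962, §8] -/
theorem formCongr_normStep {a d x y : R} (ha : σ a = a) (hd : σ d = d) (hx : σ x = x) (hy : σ y = y) (hT : IsUnit (!![x, -(d * y); y, a * x]).det) :
    formCongr σ (Matrix.GeneralLinearGroup.mk'' _ hT) (Matrix.diagonal ![a, d]) =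
      Matrix.diagonal ![a * x ^ 2 + d * y ^ 2, a * d * (a * x ^ 2 + d * y ^ 2)] := by
  ext i j
  fin_cases i <;> fin_cases j <;>
    simp [formCongr, Matrix.mul_apply, Fin.sum_univ_two, Matrix.transpose_apply, Matrix.map_apply, Matrix.diagonal, ha, hd, hx, hy] <;> ring

/-- **Rescaling the first basis vector**: `diag(s, 1)` turns `diag(c, δ)` into `diag(σ(s) c s, δ)`. [cite: Omeara1963, §92:1] -/
theorem formCongr_scale {c δ s : R} (hT : IsUnit (Matrix.diagonal ![s, (1 : R)]).det) :
    formCongr σ (Matrix.GeneralLinearGroup.mk'' _ hT) (Matrix.diagonal ![c, δ]) = Matrix.diagonal ![σ s * c * s, δ] := by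
  ext i j
  fin_cases i <;> fin_cases j <;>
    simp [formCongr, Matrix.mul_apply, Matrix.transpose_apply, Matrix.map_apply, Matrix.diagonal]

/-- **Rescaling the second basis vector**: `diag(1, f)` turns `diag(1, δ)` into `diag(1, δ · (f σ f))`. [cite: Omeara1963, §92:1] -/
theorem formCongr_scale₂ {δ f : R} (hT : IsUnit (Matrix.diagonal ![(1 : R), f]).det) :
    formCongr σ (Matrix.GeneralLinearGroup.mk'' _ hT) (Matrix.diagonal ![1, δ]) = Matrix.diagonal ![1, δ * (f * σ f)] := by
  ext i j
  fin_cases i <;> fin_cases j <;>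
    simp [formCongr, Matrix.mul_apply, Matrix.transpose_apply, Matrix.map_apply, Matrix.diagonal]
  ring

/-- A diagonal matrix with `σ`-fixed entries is `σ`-hermitian. [cite: Jacobowitz1962, §4] -/
theorem diagonal_hermitian {a d : R} (ha : σ a = a) (hd : σ d = d) : ((Matrix.diagonal ![a, d]).map σ)ᵀ = Matrix.diagonal ![a, d] := by
  ext i j
  fin_cases i <;> fin_cases j <;> simp [Matrix.diagonal, ha, hd]

end TwoByTwo

/-! ## §2 Diagonalisation to `diag(1, δ)` over a local ring with residually trivial involution -/

section Diagonal

variable [IsLocalRing R] (hσ : ∀ x, σ (σ x) = x) (h2 : IsUnit (2 : R)) (hres : ∀ r : R, σ r - r ∈ IsLocalRing.maximalIdeal R)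
  (hnorm₁ : ∀ u : R, σ u = u → u - 1 ∈ IsLocalRing.maximalIdeal R → ∃ t : R, t * σ t = u)

omit [IsLocalRing R] in
include h2 in
/-- (trace) from (two): `b = ½` has `b + σ b = 1`. [cite: Jacobowitz1962, §4] -/
theorem exists_add_map_eq_one : ∃ b : R, b + σ b = 1 := by
  obtain ⟨u, hu⟩ := h2
  have hσu : σ (u : R) = u := by rw [hu, map_ofNat]
  have hσui : σ ((u⁻¹ : Rˣ) : R) = (u⁻¹ : Rˣ) := by
    have h1 : σ ((u⁻¹ : Rˣ) : R) * (u : R) = 1 := by rw [← hσu, ← map_mul, Units.inv_mul, map_one]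
    calc σ ((u⁻¹ : Rˣ) : R) = σ ((u⁻¹ : Rˣ) : R) * (u : R) * ((u⁻¹ : Rˣ) : R) := by rw [mul_assoc, Units.mul_inv, mul_one]
      _ = (u⁻¹ : Rˣ) := by rw [h1, one_mul]
  refine ⟨(u⁻¹ : Rˣ), ?_⟩
  rw [hσui, ← two_mul, ← hu, Units.mul_inv]

include hσ h2 hres in
/-- **A `σ`-fixed lift of every residue class** under (two) + (res): `s = ½ (r + σ r)` is `σ`-fixed and `s ≡ r (mod 𝔪)`. [cite: Serre1979, Ch. V §3] -/
theorem exists_fixed_sub_mem (r : R) : ∃ s : R, σ s = s ∧ s - r ∈ IsLocalRing.maximalIdeal R := by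
  obtain ⟨b, hb⟩ := exists_add_map_eq_one σ h2
  refine ⟨b * r + σ b * σ r, ?_, ?_⟩
  · rw [map_add, map_mul, map_mul, hσ, hσ, add_comm]
  · have h : b * r + σ b * σ r - r = σ b * (σ r - r) := by linear_combination r * hb
    rw [h]
    exact Ideal.mul_mem_left _ _ (hres r)

include h2 in
/-- **The residue form `a x² + d y²` represents `1`**: for units `a, d` there are `x₀, y₀ ∈ R` with `a x₀² + d y₀² ≡ 1 (mod 𝔪)` — a non-degenerate binary form over a
FINITE field of ODD order takes every value (Mathlib `FiniteField.exists_root_sum_quadratic`; odd order by (two)). [cite: Omeara1963, §62:1] [cite: Serre1979, Ch. IV §1] -/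
theorem exists_sq_add_sq_sub_one_mem [Finite (IsLocalRing.ResidueField R)] (a d : R) (ha : IsUnit a) (hd : IsUnit d) :
    ∃ x₀ y₀ : R, a * x₀ ^ 2 + d * y₀ ^ 2 - 1 ∈ IsLocalRing.maximalIdeal R := by
  classical
  letI : Fintype (IsLocalRing.ResidueField R) := Fintype.ofFinite _
  set k := IsLocalRing.ResidueField R
  have h2k : (2 : k) ≠ 0 := by
    have h := (h2.map (IsLocalRing.residue R)).ne_zero
    rwa [map_ofNat] at h
  have hcard : Fintype.card k % 2 = 1 := by
    have hchar : ringChar k ≠ 2 := by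
      intro hc
      apply h2k
      have := ringChar.spec k 2
      rw [hc] at this
      exact_mod_cast this.2 (dvd_refl 2)
    have := (FiniteField.even_card_iff_char_two (F := k)).not.1 hchar
    omega
  set abar := IsLocalRing.residue R a
  set dbar := IsLocalRing.residue R d
  have habar : abar ≠ 0 := (ha.map (IsLocalRing.residue R)).ne_zero
  have hdbar : dbar ≠ 0 := (hd.map (IsLocalRing.residue R)).ne_zero
  have hf : (C abar * X ^ 2 : k[X]).degree = 2 := by rw [degree_C_mul_X_pow 2 habar]; rfl
  have hg : (C dbar * X ^ 2 - 1 : k[X]).degree = 2 := by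
    rw [degree_sub_eq_left_of_degree_lt] <;> rw [degree_C_mul_X_pow 2 hdbar]
    · rfl
    · rw [degree_one]; exact_mod_cast Nat.zero_lt_two
  obtain ⟨xb, yb, hxy⟩ := FiniteField.exists_root_sum_quadratic hf hg hcard
  obtain ⟨x₀, rfl⟩ := IsLocalRing.residue_surjective xb
  obtain ⟨y₀, rfl⟩ := IsLocalRing.residue_surjective yb
  refine ⟨x₀, y₀, ?_⟩
  rw [← IsLocalRing.residue_eq_zero_iff]
  simp only [eval_sub, eval_mul, eval_C, eval_pow, eval_X, eval_one] at hxy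
  simp only [map_sub, map_add, map_mul, map_pow, map_one]
  linear_combination hxy

include hσ h2 hres hnorm₁ in
/-- **The binary form `diag(a, d)` (`a, d` `σ`-fixed units) REPRESENTS A NORM, in fact `1` after rescaling**: there are `σ`-fixed `x, y` and a unit `t` with
`a x² + d y² = t σ(t)` (residue solution of `a x² + d y² = 1`, `σ`-fixed lifts, (norm₁)). [cite: Jacobowitz1962, §8] [cite: Omeara1963, §92:1] -/
theorem exists_fixed_repr_norm [Finite (IsLocalRing.ResidueField R)] {a d : R} (ha : IsUnit a) (hd : IsUnit d) (hσa : σ a = a) (hσd : σ d = d) :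
    ∃ x y t : R, σ x = x ∧ σ y = y ∧ IsUnit t ∧ a * x ^ 2 + d * y ^ 2 = t * σ t := by
  obtain ⟨x₀, y₀, hxy⟩ := exists_sq_add_sq_sub_one_mem h2 a d ha hd
  obtain ⟨x, hx, hxx⟩ := exists_fixed_sub_mem σ hσ h2 hres x₀
  obtain ⟨y, hy, hyy⟩ := exists_fixed_sub_mem σ hσ h2 hres y₀
  -- `c := a x² + d y² ≡ 1`
  have hc1 : a * x ^ 2 + d * y ^ 2 - 1 ∈ IsLocalRing.maximalIdeal R := by
    have h : a * x ^ 2 + d * y ^ 2 - 1 = (a * x₀ ^ 2 + d * y₀ ^ 2 - 1) + (a * (x + x₀) * (x - x₀) + d * (y + y₀) * (y - y₀)) := by ring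
    rw [h]
    exact Ideal.add_mem _ hxy (Ideal.add_mem _ (Ideal.mul_mem_left _ _ hxx) (Ideal.mul_mem_left _ _ hyy))
  have hσc : σ (a * x ^ 2 + d * y ^ 2) = a * x ^ 2 + d * y ^ 2 := by rw [map_add, map_mul, map_mul, map_pow, map_pow, hσa, hσd, hx, hy]
  obtain ⟨t, ht⟩ := hnorm₁ _ hσc hc1
  have hcu : IsUnit (a * x ^ 2 + d * y ^ 2) := by
    by_contra hnu
    have hmem : a * x ^ 2 + d * y ^ 2 ∈ IsLocalRing.maximalIdeal R := (IsLocalRing.mem_maximalIdeal _).2 (mem_nonunits_iff.2 hnu)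
    have h1 : (1 : R) ∈ IsLocalRing.maximalIdeal R := by
      have := Ideal.sub_mem _ hmem hc1
      rwa [sub_sub_cancel] at this
    exact (IsLocalRing.maximalIdeal.isMaximal R).ne_top ((Ideal.eq_top_iff_one _).2 h1)
  refine ⟨x, y, t, hx, hy, ?_, ht.symm⟩
  rw [← ht] at hcu
  exact isUnit_of_mul_isUnit_left hcu

include hσ h2 in
/-- **Steps 1–2 (unit pivot + Schur split)**: a unimodular `σ`-hermitian `H ∈ M₂(R)` is congruent to `diag(a, d)` with `σ`-fixed units `a, d` (★
`HermitianUnimodular.exists_isUnit_formCongr_diag` for the pivot, with (trace) from (two); a swap if the pivot sits at position `1`). [cite: Jacobowitz1962, §4 (4.2)–(4.4)] -/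
theorem exists_formCongr_eq_diagonal (H : Matrix (Fin 2) (Fin 2) R) (hH : (H.map σ)ᵀ = H) (hdet : IsUnit H.det) :
    ∃ (T : GL (Fin 2) R) (a d : R), σ a = a ∧ σ d = d ∧ IsUnit a ∧ IsUnit d ∧ formCongr σ T H = Matrix.diagonal ![a, d] := by
  -- a unit pivot at position `0`
  obtain ⟨E₀, p, hp⟩ := HermitianUnimodular.exists_isUnit_formCongr_diag σ (exists_add_map_eq_one σ h2) H hH hdet
  have hswap : ∃ E : GL (Fin 2) R, IsUnit (formCongr σ E H 0 0) := by
    fin_cases p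
    · exact ⟨E₀, hp⟩
    · have hSdet : IsUnit (!![(0 : R), 1; 1, 0]).det := by rw [Matrix.det_fin_two_of]; simp
      refine ⟨E₀ * Matrix.GeneralLinearGroup.mk'' _ hSdet, ?_⟩
      rw [formCongr_mul_eq_formCongr_formCongr, formCongr_swap]
      simpa using hp
  obtain ⟨E, hE⟩ := hswap
  set H' := formCongr σ E H with hH'def
  have hH' : (H'.map σ)ᵀ = H' := formCongr_hermitian σ hσ E hH
  have hdet' : IsUnit H'.det := by
    rw [hH'def, det_formCongr]
    exact hdet.mul ((Matrix.isUnits_det_units E).mul ((Matrix.isUnits_det_units E).map σ))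
  -- entries: `H' = !![a, b; σ b, e]`
  set a := H' 0 0 with hadef
  set b := H' 0 1 with hbdef
  set e := H' 1 1 with hedef
  have h10 : H' 1 0 = σ b := by
    have := congrFun (congrFun hH' 1) 0
    rw [Matrix.transpose_apply, Matrix.map_apply] at this
    exact this.symm
  have hσa : σ a = a := by
    have := congrFun (congrFun hH' 0) 0
    rw [Matrix.transpose_apply, Matrix.map_apply] at this
    exact this
  have hσe : σ e = e := by
    have := congrFun (congrFun hH' 1) 1
    rw [Matrix.transpose_apply, Matrix.map_apply] at this
    exact this
  have hH'eq : H' = !![a, b; σ b, e] := by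
    ext i j; fin_cases i <;> fin_cases j
    · rfl
    · rfl
    · exact h10
    · rfl
  obtain ⟨au, hau⟩ := hE
  have hai : a * ↑au⁻¹ = 1 := by rw [← hau, Units.mul_inv]
  have hσai : σ (↑au⁻¹ : R) * a = 1 := by
    have h1 : σ (↑au⁻¹ : R) * σ a = 1 := by rw [← map_mul, ← hau, Units.inv_mul, map_one]
    rwa [hσa] at h1
  have hT₁ : IsUnit (!![(1 : R), -(↑au⁻¹ * b); 0, 1]).det := by rw [Matrix.det_fin_two_of]; simp
  set d := e - σ (↑au⁻¹ * b) * b with hddef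
  have hσaieq : σ (↑au⁻¹ : R) = ↑au⁻¹ := by
    calc σ (↑au⁻¹ : R) = σ (↑au⁻¹ : R) * (a * ↑au⁻¹) := by rw [hai, mul_one]
      _ = σ (↑au⁻¹ : R) * a * ↑au⁻¹ := by ring
      _ = ↑au⁻¹ := by rw [hσai, one_mul]
  have hσd : σ d = d := by
    simp only [hddef, map_sub, map_mul, hσe, hσaieq, hσ]
    ring
  refine ⟨E * Matrix.GeneralLinearGroup.mk'' _ hT₁, a, d, hσa, hσd, ⟨au, hau⟩, ?_, ?_⟩
  · -- `d` is a unit: `det diag(a, d) = a d` is a unit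
    have hdiag : formCongr σ (E * Matrix.GeneralLinearGroup.mk'' _ hT₁) H = Matrix.diagonal ![a, d] := by
      rw [formCongr_mul_eq_formCongr_formCongr, ← hH'def, hH'eq, formCongr_schur σ hai hσai rfl hT₁]
      ext i j; fin_cases i <;> fin_cases j <;> simp [Matrix.diagonal, hddef]
    have hdu : IsUnit (formCongr σ (E * Matrix.GeneralLinearGroup.mk'' _ hT₁) H).det := by
      rw [det_formCongr]
      exact hdet.mul ((Matrix.isUnits_det_units _).mul ((Matrix.isUnits_det_units _).map σ))
    rw [hdiag, Matrix.det_diagonal, Fin.prod_univ_two] at hdu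
    simp only [Matrix.cons_val_zero, Matrix.cons_val_one, Matrix.cons_val_fin_one] at hdu
    exact isUnit_of_mul_isUnit_right hdu
  · rw [formCongr_mul_eq_formCongr_formCongr, ← hH'def, hH'eq, formCongr_schur σ hai hσai rfl hT₁]
    ext i j; fin_cases i <;> fin_cases j <;> simp [Matrix.diagonal, hddef]

include hσ h2 hres hnorm₁ in
/-- **Every unimodular `σ`-hermitian `H ∈ M₂(R)` is congruent to `diag(1, δ)`** for a `σ`-fixed unit `δ` (= `det H` times a norm), over a local ring with (two), (res),
(norm₁) and finite residue field: split to `diag(a, d)`, represent a norm `c = a x² + d y² = t σ t` by the vector `(x, y)`, complete it by `(−d y, a x)` to a basis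
(Gram `diag(c, a d c)`), rescale the first vector by `t⁻¹`. [cite: Jacobowitz1962, §8] [cite: Omeara1963, §92:1–92:2] -/
theorem exists_formCongr_eq_diagonal_one [Finite (IsLocalRing.ResidueField R)] (H : Matrix (Fin 2) (Fin 2) R) (hH : (H.map σ)ᵀ = H) (hdet : IsUnit H.det) :
    ∃ (T : GL (Fin 2) R) (δ : R), σ δ = δ ∧ IsUnit δ ∧ formCongr σ T H = Matrix.diagonal ![1, δ] := by
  obtain ⟨T₁, a, d, hσa, hσd, ha, hd, h1⟩ := exists_formCongr_eq_diagonal σ hσ h2 H hH hdet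
  obtain ⟨x, y, t, hx, hy, ht, hc⟩ := exists_fixed_repr_norm σ hσ h2 hres hnorm₁ ha hd hσa hσd
  -- the completed basis
  have hT₂ : IsUnit (!![x, -(d * y); y, a * x]).det := by
    rw [Matrix.det_fin_two_of]
    have : x * (a * x) - -(d * y) * y = a * x ^ 2 + d * y ^ 2 := by ring
    rw [this, hc]
    exact ht.mul (ht.map σ)
  -- the rescaling by `t⁻¹`
  obtain ⟨tu, htu⟩ := ht
  have ht : IsUnit t := ⟨tu, htu⟩
  have hT₃ : IsUnit (Matrix.diagonal ![((tu⁻¹ : Rˣ) : R), (1 : R)]).det := by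
    rw [Matrix.det_diagonal, Fin.prod_univ_two]; simp
  refine ⟨T₁ * Matrix.GeneralLinearGroup.mk'' _ hT₂ * Matrix.GeneralLinearGroup.mk'' _ hT₃, a * d * (t * σ t), ?_, ?_, ?_⟩
  · rw [map_mul, map_mul, map_mul, hσa, hσd, hσ]; ring
  · exact (ha.mul hd).mul (ht.mul (ht.map σ))
  · rw [formCongr_mul_eq_formCongr_formCongr, formCongr_mul_eq_formCongr_formCongr, h1, formCongr_normStep σ hσa hσd hx hy hT₂, hc,
      formCongr_scale σ hT₃]
    congr 1
    ext i; fin_cases i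
    · -- `σ(t⁻¹) (t σ t) t⁻¹ = 1`
      simp only [Fin.zero_eta, Fin.isValue, Matrix.cons_val_zero]
      have hinv : ((tu⁻¹ : Rˣ) : R) * t = 1 := by rw [← htu, Units.inv_mul]
      have hσinv : σ ((tu⁻¹ : Rˣ) : R) * σ t = 1 := by rw [← map_mul, hinv, map_one]
      linear_combination (σ ((tu⁻¹ : Rˣ) : R) * σ t) * hinv + hσinv
    · rfl

end Diagonal

/-! ## §3 Congruence of two planes with the same determinant class -/

section DetClass

variable [IsLocalRing R] (hσ : ∀ x, σ (σ x) = x) (h2 : IsUnit (2 : R)) (hres : ∀ r : R, σ r - r ∈ IsLocalRing.maximalIdeal R)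
  (hnorm₁ : ∀ u : R, σ u = u → u - 1 ∈ IsLocalRing.maximalIdeal R → ∃ t : R, t * σ t = u)

include hσ h2 hres hnorm₁ in
/-- **TWO UNIMODULAR HERMITIAN PLANES WITH THE SAME DETERMINANT CLASS ARE CONGRUENT** (ramified Jacobowitz, rank `2`): over a local ring `R` with involution `σ`
satisfying (two), (res), (norm₁) and with finite residue field, if `H₁, H₂ ∈ M₂(R)` are `σ`-hermitian and unimodular with `det H₂ = det H₁ · (t σ t)` for some
`t ∈ R`, then `∃ T ∈ GL₂(R), (σT)ᵀ H₁ T = H₂`.  (All Gram matrices of the lattices of ONE hermitian plane `(E_w², H)` satisfy the hypothesis: congruence over the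
FIELD multiplies `det` by the norm `det g · σ(det g)`.) [cite: Jacobowitz1962, §8] [cite: Omeara1963, §92:2] -/
theorem exists_formCongr_eq_of_det_eq_mul_norm [Finite (IsLocalRing.ResidueField R)] (H₁ H₂ : Matrix (Fin 2) (Fin 2) R)
    (hH₁ : (H₁.map σ)ᵀ = H₁) (hdet₁ : IsUnit H₁.det) (hH₂ : (H₂.map σ)ᵀ = H₂) (hdet₂ : IsUnit H₂.det)
    (t : R) (hdet : H₂.det = H₁.det * (t * σ t)) :
    ∃ T : GL (Fin 2) R, formCongr σ T H₁ = H₂ := by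
  obtain ⟨T₁, δ₁, hσδ₁, hδ₁, h₁⟩ := exists_formCongr_eq_diagonal_one σ hσ h2 hres hnorm₁ H₁ hH₁ hdet₁
  obtain ⟨T₂, δ₂, hσδ₂, hδ₂, h₂⟩ := exists_formCongr_eq_diagonal_one σ hσ h2 hres hnorm₁ H₂ hH₂ hdet₂
  -- determinants: `δᵢ = det Hᵢ · N(det Tᵢ)`, so `δ₂ = δ₁ · N(f)` with `f = t · det T₂ ∕ det T₁`
  have hd₁ : δ₁ = H₁.det * ((T₁ : Matrix (Fin 2) (Fin 2) R).det * σ (T₁ : Matrix (Fin 2) (Fin 2) R).det) := by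
    have := det_formCongr σ T₁ H₁
    rw [h₁, Matrix.det_diagonal, Fin.prod_univ_two] at this
    simpa using this
  have hd₂ : δ₂ = H₂.det * ((T₂ : Matrix (Fin 2) (Fin 2) R).det * σ (T₂ : Matrix (Fin 2) (Fin 2) R).det) := by
    have := det_formCongr σ T₂ H₂
    rw [h₂, Matrix.det_diagonal, Fin.prod_univ_two] at this
    simpa using this
  obtain ⟨u₁, hu₁⟩ := Matrix.isUnits_det_units T₁
  set f : R := t * (T₂ : Matrix (Fin 2) (Fin 2) R).det * ((u₁⁻¹ : Rˣ) : R) with hfdef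
  have hu₁inv : ((u₁⁻¹ : Rˣ) : R) * (T₁ : Matrix (Fin 2) (Fin 2) R).det = 1 := by rw [← hu₁, Units.inv_mul]
  have hσu₁inv : σ ((u₁⁻¹ : Rˣ) : R) * σ (T₁ : Matrix (Fin 2) (Fin 2) R).det = 1 := by rw [← map_mul, hu₁inv, map_one]
  have hδ : δ₂ = δ₁ * (f * σ f) := by
    rw [hd₂, hdet, hd₁, hfdef, map_mul, map_mul]
    linear_combination (H₁.det * (t * σ t) * ((T₂ : Matrix (Fin 2) (Fin 2) R).det * σ (T₂ : Matrix (Fin 2) (Fin 2) R).det)) *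
      (-(σ ((u₁⁻¹ : Rˣ) : R) * σ (T₁ : Matrix (Fin 2) (Fin 2) R).det) * hu₁inv - hσu₁inv)
  -- `f` is a unit (it divides the unit `δ₂` after multiplying by units… simplest: `t` is a unit since `t σ t = det H₂ ∕ det H₁`)
  have hfu : IsUnit f := by
    have htt : IsUnit (t * σ t) := by
      obtain ⟨v, hv⟩ := hdet₁
      have : t * σ t = ((v⁻¹ : Rˣ) : R) * H₂.det := by rw [hdet, ← hv, ← mul_assoc, Units.inv_mul, one_mul]
      rw [this]
      exact (Units.isUnit _).mul hdet₂
    exact ((isUnit_of_mul_isUnit_left htt).mul (Matrix.isUnits_det_units T₂)).mul (Units.isUnit _)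
  have hT₃ : IsUnit (Matrix.diagonal ![(1 : R), f]).det := by
    rw [Matrix.det_diagonal, Fin.prod_univ_two]; simpa using hfu
  refine ⟨T₁ * Matrix.GeneralLinearGroup.mk'' _ hT₃ * T₂⁻¹, ?_⟩
  rw [formCongr_mul_eq_formCongr_formCongr, formCongr_mul_eq_formCongr_formCongr, h₁, formCongr_scale₂ σ hT₃, ← hδ, ← h₂, formCongr_inv_formCongr]

end DetClass

end Literature.NumberTheory.QuadraticForms.HermitianUnimodularRamified
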